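import Mathlib.LinearAlgebra.Basis.VectorSpace
import Literature.Computability.AlgebraicComplexity.SLOrbitQuotientHolds
import Literature.Computability.AlgebraicComplexity.MS2001StableObstructionMultiplicityAllFields
import HarnessLib

/-!
# The orbit map of a closed `SL`-orbit of forms is a quotient — over every algebraically closed
# field of characteristic `0`

Topic `Literature/Computability/AlgebraicComplexity`. THEOREMS ONLY (no definition, no new fact).

The tree's named fact `Grosshans1997_thm_1_11_slOrbit_forms` (`SLOrbitMapQuotient.lean`; Borel LAG
Prop. 6.7 = Grosshans 1997 Thm. 1.11 for a polystable form `w`: every polynomial function on `SL_σ`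
invariant under right translation by the stabiliser `SL_w` is the pull-back of a polynomial in the
coefficients of `g · w`) is typed over `ℂ` and discharged there
(`SLOrbitQuotientHolds.Grosshans1997_thm_1_11_slOrbit_forms_holds`). The printed theorem holds over
every algebraically closed field of characteristic `0`; this file proves that version,
`Grosshans1997_thm_1_11_slOrbit_forms_charZero`, from the `ℂ` theorem by the algebraic Lefschetz
principle — the same base-change kit that discharged `MS2001_thm_5_1`
(`ZariskiClosureBaseChange`, `PolystableBaseChange`, `FixedFormsBaseChange`,
`MS2001StableObstructionMultiplicityAllFields`):

* § 1 the hypothesis «`f(g h) = f(g)` for `g ∈ SL_σ`, `h ∈ SL_w`» descends along a field extension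
  `k → K` (injectivity of `algebraMap`) and ascends when `k` is algebraically closed (it is a
  polynomial identity on the `k`-variety `SL_σ × SL_w`, whose `k`-points are Zariski dense in its
  `K`-points: Milne, Prop. 1.11 / Cor. 1.17; here by Hilbert's Nullstellensatz,
  `aeval_eq_zero_of_forall_zeroLocus`);
* § 2 the conclusion «`f(g) = Φ(g · w)` on `SL_σ`» descends from `K` to `k` by applying a `k`-linear
  retraction `K → k` coefficientwise to `Φ` (`SL_σ(k) ⊆ SL_σ(K)`, and `g · w` has coordinates in
  `k`), and ascends from an algebraically closed `k` to `K` by density of `SL_σ(k)` in `SL_σ(K)`;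
* § 3 the coefficients of `w` and `f` lie in a countable algebraically closed subfield `k ⊆ F`,
  which embeds into `ℂ` (Steinitz; tree `EmbeddingIntoComplex`); polystability is unchanged under
  both base changes (`IsPolystable.of_map`, `IsPolystable.map`), so the `ℂ` theorem applies to
  `w_ℂ`, and its polynomial `Φ_ℂ` is transported back: `ℂ ↝ k ↝ F`.

Honest framing: a theorem of algebraic group theory, now available in the generality in which it is
printed (characteristic `0`); bookkeeping for row GRO97-A of the `val-lit` ladder; nothing here
bears on VP versus VNP, which is NOT proved.

## References

* [Grosshans1997] F. D. Grosshans, *Algebraic Homogeneous Spaces and Invariant Theory*, LNM 1673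
  (1997), Thm. 1.11 (quoting Borel, LAG, Prop. 6.7).
* [Milne2017AlgebraicGroups] J. S. Milne, *Algebraic Groups*, CUP (2017), §1.e (extension of
  scalars), Prop. 1.11, Cor. 1.17, A.48 (density of rational points under extension of an
  algebraically closed base field).
* [SpringerLAG1998] T. A. Springer, *Linear Algebraic Groups*, 2nd ed. (1998), 5.5.5.

## Provenance

Cell `val-lit`, programme #10 (follow-up): literature-prover val-lit-x3 g5, 2026-08-27.
-/

noncomputable section

open MvPolynomial Cardinal

namespace Literature.Computability.AlgebraicComplexity

/-! ### § 1 The hypothesis «`f(g h) = f(g)` for `h ∈ SL_w`» under base change -/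

section Hypothesis

variable {k K : Type*} [Field k] [Field K] [Algebra k K] {σ : Type*} [Fintype σ] [DecidableEq σ]

/-- **Descent of right `SL_w`-invariance.** If `f_K(g h) = f_K(g)` for all `g ∈ SL_σ(K)` and all
`h ∈ SL_σ(K)` stabilising `w_K`, then `f(g h) = f(g)` for all `g ∈ SL_σ(k)` and `h ∈ SL_σ(k)`
stabilising `w` (`SL_σ(k) ⊆ SL_σ(K)` and `algebraMap k K` is injective).
[cite: Milne2017AlgebraicGroups, §1.e (extension of scalars)] -/
theorem rightStabInvariant_of_map (w₀ : MvPolynomial σ k) (f₀ : MvPolynomial (σ × σ) k)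
    (hf : ∀ g h : Matrix σ σ K, g.det = 1 → h.det = 1 →
      linSubst σ K h (map (algebraMap k K) w₀) = map (algebraMap k K) w₀ →
        MvPolynomial.eval (fun ij : σ × σ => (g * h) ij.1 ij.2) (map (algebraMap k K) f₀) =
          MvPolynomial.eval (fun ij : σ × σ => g ij.1 ij.2) (map (algebraMap k K) f₀))
    (g h : Matrix σ σ k) (hg : g.det = 1) (hh : h.det = 1) (hhw : linSubst σ k h w₀ = w₀) :
    MvPolynomial.eval (fun ij : σ × σ => (g * h) ij.1 ij.2) f₀ =
      MvPolynomial.eval (fun ij : σ × σ => g ij.1 ij.2) f₀ := by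
  apply (algebraMap k K).injective
  rw [← eval_algebraMap_comp_map (K := K) (fun ij : σ × σ => (g * h) ij.1 ij.2) f₀,
    ← eval_algebraMap_comp_map (K := K) (fun ij : σ × σ => g ij.1 ij.2) f₀]
  have hmul : (fun ij : σ × σ => algebraMap k K ((g * h) ij.1 ij.2)) =
      fun ij : σ × σ => (g.map (algebraMap k K) * h.map (algebraMap k K)) ij.1 ij.2 := by
    funext ij
    rw [← Matrix.map_mul]
    rfl
  rw [hmul]
  refine hf _ _ ?_ ?_ ?_
  · rw [← RingHom.mapMatrix_apply, ← RingHom.map_det, hg, map_one]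
  · rw [← RingHom.mapMatrix_apply, ← RingHom.map_det, hh, map_one]
  · rw [← map_linSubst, hhw]

omit [Field K] [Algebra k K] [DecidableEq σ] in
/-- Evaluation of `f₀(X · Y)` (the polynomial `f₀` composed with the product of the two generic
matrices `X = (X_{inl (i,j)})`, `Y = (X_{inr (i,j)})`) at a point `z` of `Mat × Mat` is `f₀` at the
product of the two matrices read off from `z`. [folklore] -/
private theorem aeval_aeval_prodEntries {R : Type*} [CommRing R] [Algebra k R]
    (f₀ : MvPolynomial (σ × σ) k) (z : (σ × σ) ⊕ (σ × σ) → R) :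
    aeval z (aeval (fun ij : σ × σ => ∑ l : σ,
        (X (Sum.inl (ij.1, l)) : MvPolynomial ((σ × σ) ⊕ (σ × σ)) k) * X (Sum.inr (l, ij.2))) f₀) =
      aeval (fun ij : σ × σ => ((Matrix.of fun i j : σ => z (Sum.inl (i, j))) *
        (Matrix.of fun i j : σ => z (Sum.inr (i, j)))) ij.1 ij.2) f₀ := by
  rw [← AlgHom.comp_apply, comp_aeval]
  have hFG : (fun ij : σ × σ => aeval z (∑ l : σ,
      (X (Sum.inl (ij.1, l)) : MvPolynomial ((σ × σ) ⊕ (σ × σ)) k) * X (Sum.inr (l, ij.2)))) =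
      fun ij : σ × σ => ((Matrix.of fun i j : σ => z (Sum.inl (i, j))) *
        (Matrix.of fun i j : σ => z (Sum.inr (i, j)))) ij.1 ij.2 := by
    funext ij
    simp only [map_sum, map_mul, aeval_X, Matrix.mul_apply, Matrix.of_apply]
  rw [hFG]

/-- **Points of the `k`-variety `SL_σ × SL_w`** in an extension field `R`: a point `z = (G, H)` of
`Mat × Mat` is a common zero of `det X - 1`, `det Y - 1` and the equations `coeff_d (Y · w) =
coeff_d w` iff `det G = 1`, `det H = 1` and `H · w_R = w_R`.
[cite: Milne2017AlgebraicGroups, §1.e (extension of scalars)] -/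
private theorem mem_zeroLocus_pairSpan_iff {R : Type*} [Field R] [Algebra k R]
    (w₀ : MvPolynomial σ k) (z : (σ × σ) ⊕ (σ × σ) → R) :
    z ∈ MvPolynomial.zeroLocus R (Ideal.span
        (insert (rename Sum.inl ((Matrix.mvPolynomialX σ σ k).det - 1))
          (rename Sum.inr '' insert ((Matrix.mvPolynomialX σ σ k).det - 1)
            (Set.range fun d : σ →₀ ℕ => genericCoeff w₀ d - C (coeff d w₀))))) ↔
      (Matrix.of fun i j : σ => z (Sum.inl (i, j))).det = 1 ∧
        (Matrix.of fun i j : σ => z (Sum.inr (i, j))).det = 1 ∧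
          linSubst σ R (Matrix.of fun i j : σ => z (Sum.inr (i, j))) (map (algebraMap k R) w₀) =
            map (algebraMap k R) w₀ := by
  have hstab := mem_zeroLocus_stabIdeal_iff (K := R) w₀ (Matrix.of fun i j : σ => z (Sum.inr (i, j)))
  rw [stabIdeal, MvPolynomial.zeroLocus_span] at hstab
  have hinl : (z ∘ Sum.inl) = fun ij : σ × σ => (Matrix.of fun i j : σ => z (Sum.inl (i, j))) ij.1 ij.2 :=
    rfl
  have hinr : (z ∘ Sum.inr) = fun ij : σ × σ => (Matrix.of fun i j : σ => z (Sum.inr (i, j))) ij.1 ij.2 :=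
    rfl
  rw [MvPolynomial.zeroLocus_span]
  constructor
  · intro h
    refine ⟨?_, hstab.mp fun q hq => ?_⟩
    · have h1 := h _ (Set.mem_insert _ _)
      rwa [aeval_rename, hinl, map_sub, map_one, aeval_det_mvPolynomialX, sub_eq_zero] at h1
    · have h1 := h _ (Set.mem_insert_of_mem _ ⟨q, hq, rfl⟩)
      rwa [aeval_rename, hinr] at h1
  · rintro ⟨hG, hH⟩ p hp
    rcases hp with rfl | ⟨q, hq, rfl⟩
    · rw [aeval_rename, hinl, map_sub, map_one, aeval_det_mvPolynomialX, hG, sub_self]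
    · rw [aeval_rename, hinr]
      exact hstab.mpr hH q hq

/-- **Ascent of right `SL_w`-invariance** (`k` algebraically closed). If `f(g h) = f(g)` for all
`g ∈ SL_σ(k)` and `h ∈ SL_σ(k)` stabilising `w`, then `f_K(g h) = f_K(g)` for all `g ∈ SL_σ(K)` and
`h ∈ SL_σ(K)` stabilising `w_K`: the identity `f(X Y) = f(X)` holds on the `k`-points of the
`k`-variety `SL_σ × SL_w`, hence (Nullstellensatz: the `k`-points are dense) on its `K`-points.
[cite: Milne2017AlgebraicGroups, Prop. 1.11 / Cor. 1.17 / A.48] -/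
theorem rightStabInvariant_map [IsAlgClosed k] (w₀ : MvPolynomial σ k)
    (f₀ : MvPolynomial (σ × σ) k)
    (hf : ∀ g h : Matrix σ σ k, g.det = 1 → h.det = 1 → linSubst σ k h w₀ = w₀ →
      MvPolynomial.eval (fun ij : σ × σ => (g * h) ij.1 ij.2) f₀ =
        MvPolynomial.eval (fun ij : σ × σ => g ij.1 ij.2) f₀)
    (g h : Matrix σ σ K) (hg : g.det = 1) (hh : h.det = 1)
    (hhw : linSubst σ K h (map (algebraMap k K) w₀) = map (algebraMap k K) w₀) :
    MvPolynomial.eval (fun ij : σ × σ => (g * h) ij.1 ij.2) (map (algebraMap k K) f₀) =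
      MvPolynomial.eval (fun ij : σ × σ => g ij.1 ij.2) (map (algebraMap k K) f₀) := by
  classical
  -- the equations of `SL_σ × SL_w ⊆ Mat × Mat` and the polynomial `f₀(X Y) - f₀(X)`
  let S : Set (MvPolynomial ((σ × σ) ⊕ (σ × σ)) k) :=
    insert (rename Sum.inl ((Matrix.mvPolynomialX σ σ k).det - 1))
      (rename Sum.inr '' insert ((Matrix.mvPolynomialX σ σ k).det - 1)
        (Set.range fun d : σ →₀ ℕ => genericCoeff w₀ d - C (coeff d w₀)))
  let P : MvPolynomial ((σ × σ) ⊕ (σ × σ)) k :=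
    aeval (fun ij : σ × σ => ∑ l : σ,
      (X (Sum.inl (ij.1, l)) : MvPolynomial ((σ × σ) ⊕ (σ × σ)) k) * X (Sum.inr (l, ij.2))) f₀ -
      rename Sum.inl f₀
  -- the identity on `k`-points
  have hk : ∀ x ∈ MvPolynomial.zeroLocus k (Ideal.span S), aeval x P = 0 := by
    intro x hx
    obtain ⟨hG, hH, hHw⟩ := (mem_zeroLocus_pairSpan_iff (R := k) w₀ x).mp hx
    rw [Algebra.algebraMap_self, map_id] at hHw
    have h1 := hf _ _ hG hH hHw
    show aeval x (aeval _ f₀ - rename Sum.inl f₀) = 0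
    rw [map_sub, aeval_aeval_prodEntries, aeval_rename, sub_eq_zero]
    exact h1
  -- the `K`-point `(g, h)`
  let y : (σ × σ) ⊕ (σ × σ) → K := Sum.elim (fun ij : σ × σ => g ij.1 ij.2) (fun ij => h ij.1 ij.2)
  have hGy : (Matrix.of fun i j : σ => y (Sum.inl (i, j))) = g := by
    ext i j
    rfl
  have hHy : (Matrix.of fun i j : σ => y (Sum.inr (i, j))) = h := by
    ext i j
    rfl
  have hy : y ∈ MvPolynomial.zeroLocus K (Ideal.span S) := by
    refine (mem_zeroLocus_pairSpan_iff (R := K) w₀ y).mpr ⟨?_, ?_, ?_⟩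
    · rw [hGy]; exact hg
    · rw [hHy]; exact hh
    · rw [hHy]; exact hhw
  have hK := aeval_eq_zero_of_forall_zeroLocus (K := K) (Ideal.span S) hk hy
  have hP : aeval y P = aeval y (aeval (fun ij : σ × σ => ∑ l : σ,
      (X (Sum.inl (ij.1, l)) : MvPolynomial ((σ × σ) ⊕ (σ × σ)) k) * X (Sum.inr (l, ij.2))) f₀) -
      aeval y (rename Sum.inl f₀) := map_sub _ _ _
  rw [hP, aeval_aeval_prodEntries, aeval_rename, hGy, hHy, sub_eq_zero] at hK
  have hinl : (y ∘ Sum.inl) = fun ij : σ × σ => g ij.1 ij.2 := rfl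
  rw [hinl, aeval_def, aeval_def, ← eval_map, ← eval_map] at hK
  exact hK

end Hypothesis

/-! ### § 2 The conclusion «`f = Φ(g · w)` on `SL_σ`» under base change -/

section Conclusion

variable {k K : Type*} [Field k] [Field K] [Algebra k K] {σ : Type*} [Fintype σ] [DecidableEq σ]

omit [Fintype σ] [DecidableEq σ] in
/-- **Coefficientwise retraction.** For a `k`-linear map `λ : K → k` and a polynomial `Φ` over `K`
there is a polynomial `Φ₀` over `k` (namely `λ` applied to the coefficients of `Φ`) with
`λ (Φ(x)) = Φ₀(x)` at every `k`-rational point `x`. [folklore] -/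
private theorem exists_poly_retraction {ι : Type*} (lam : K →ₗ[k] k) (Φ : MvPolynomial ι K) :
    ∃ Φ₀ : MvPolynomial ι k, ∀ x : ι → k,
      lam (aeval (fun i => algebraMap k K (x i)) Φ) = aeval x Φ₀ := by
  classical
  refine ⟨∑ e ∈ Φ.support, monomial e (lam (coeff e Φ)), fun x => ?_⟩
  show lam (MvPolynomial.eval (fun i => algebraMap k K (x i)) Φ) =
    MvPolynomial.eval x (∑ e ∈ Φ.support, monomial e (lam (coeff e Φ)))
  rw [MvPolynomial.eval_eq, map_sum, map_sum]
  refine Finset.sum_congr rfl fun e _ => ?_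
  have hprod : ∏ i ∈ e.support, algebraMap k K (x i) ^ e i =
      algebraMap k K (∏ i ∈ e.support, x i ^ e i) := by
    rw [map_prod]
    simp only [map_pow]
  rw [hprod, mul_comm (coeff e Φ), ← Algebra.smul_def, map_smul, smul_eq_mul, eval_monomial,
    Finsupp.prod]
  exact mul_comm _ _

/-- **Descent of the orbit-quotient polynomial.** If `f_K(g) = Φ(g · w_K)` on `SL_σ(K)` for some
polynomial `Φ` over `K` in the coordinates of `Sym^m`, then `f(g) = Φ₀(g · w)` on `SL_σ(k)` for some
polynomial `Φ₀` over `k` — apply a `k`-linear retraction `K → k` to the coefficients of `Φ`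
(`SL_σ(k) ⊆ SL_σ(K)`; `g · w` has coordinates in `k`).
[cite: Milne2017AlgebraicGroups, §1.e (extension of scalars)] -/
theorem exists_orbitQuotientPoly_of_map (w₀ : MvPolynomial σ k) (m : ℕ)
    (f₀ : MvPolynomial (σ × σ) k)
    (h : ∃ Φ : MvPolynomial (DegIdx σ m) K, ∀ g : Matrix σ σ K, g.det = 1 →
      MvPolynomial.eval (fun ij : σ × σ => g ij.1 ij.2) (map (algebraMap k K) f₀) =
        aeval (formCoeff m (linSubst σ K g (map (algebraMap k K) w₀))) Φ) :
    ∃ Φ₀ : MvPolynomial (DegIdx σ m) k, ∀ g : Matrix σ σ k, g.det = 1 →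
      MvPolynomial.eval (fun ij : σ × σ => g ij.1 ij.2) f₀ =
        aeval (formCoeff m (linSubst σ k g w₀)) Φ₀ := by
  classical
  obtain ⟨Φ, hΦ⟩ := h
  -- a `k`-linear retraction of `algebraMap k K`
  have hker : LinearMap.ker (Algebra.linearMap k K) = ⊥ :=
    LinearMap.ker_eq_bot.mpr fun a b hab => (algebraMap k K).injective hab
  obtain ⟨lam, hlam⟩ := (Algebra.linearMap k K).exists_leftInverse_of_injective hker
  have hlam' : ∀ a : k, lam (algebraMap k K a) = a := fun a => by
    simpa using LinearMap.congr_fun hlam a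
  obtain ⟨Φ₀, hΦ₀⟩ := exists_poly_retraction lam Φ
  refine ⟨Φ₀, fun g hg => ?_⟩
  have h1 := hΦ (g.map (algebraMap k K))
    (by rw [← RingHom.mapMatrix_apply, ← RingHom.map_det, hg, map_one])
  have e1 : MvPolynomial.eval (fun ij : σ × σ => g.map (algebraMap k K) ij.1 ij.2)
      (map (algebraMap k K) f₀) =
      algebraMap k K (MvPolynomial.eval (fun ij : σ × σ => g ij.1 ij.2) f₀) :=
    eval_algebraMap_comp_map (K := K) _ f₀
  have e2 : formCoeff m (linSubst σ K (g.map (algebraMap k K)) (map (algebraMap k K) w₀)) =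
      fun d => algebraMap k K (formCoeff m (linSubst σ k g w₀) d) := by
    funext d
    rw [← map_linSubst, formCoeff_apply, formCoeff_apply, coeff_map]
  rw [e1, e2] at h1
  have h2 := congrArg lam h1
  rw [hlam', hΦ₀] at h2
  exact h2

/-- **Ascent of the orbit-quotient polynomial** (`k` algebraically closed). If `f(g) = Φ₀(g · w)` on
`SL_σ(k)`, then `f_K(g) = (Φ₀)_K(g · w_K)` on `SL_σ(K)`: a polynomial identity on the dense set of
`k`-points of `SL_σ` (Nullstellensatz). [cite: Milne2017AlgebraicGroups, Prop. 1.11 / Cor. 1.17 / A.48] -/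
theorem orbitQuotientPoly_map [IsAlgClosed k] (w₀ : MvPolynomial σ k) (m : ℕ)
    (f₀ : MvPolynomial (σ × σ) k) (Φ₀ : MvPolynomial (DegIdx σ m) k)
    (hΦ₀ : ∀ g : Matrix σ σ k, g.det = 1 →
      MvPolynomial.eval (fun ij : σ × σ => g ij.1 ij.2) f₀ =
        aeval (formCoeff m (linSubst σ k g w₀)) Φ₀)
    (g : Matrix σ σ K) (hg : g.det = 1) :
    MvPolynomial.eval (fun ij : σ × σ => g ij.1 ij.2) (map (algebraMap k K) f₀) =
      aeval (formCoeff m (linSubst σ K g (map (algebraMap k K) w₀))) (map (algebraMap k K) Φ₀) := by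
  classical
  let Q : MvPolynomial (σ × σ) k := f₀ - aeval (fun d : DegIdx σ m => genericCoeff w₀ d.1) Φ₀
  let I : Ideal (MvPolynomial (σ × σ) k) := Ideal.span {(Matrix.mvPolynomialX σ σ k).det - 1}
  -- the identity `f₀ = Φ₀(genericCoeff w₀)` on `SL_σ(k)`
  have hk : ∀ x ∈ MvPolynomial.zeroLocus k I, aeval x Q = 0 := by
    intro x hx
    rw [MvPolynomial.zeroLocus_span] at hx
    have hx1 : aeval x ((Matrix.mvPolynomialX σ σ k).det - 1) = 0 := hx _ (Set.mem_singleton _)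
    have hx' : x = fun ij : σ × σ => (Matrix.of fun i j : σ => x (i, j)) ij.1 ij.2 := rfl
    rw [hx'] at hx1 ⊢
    rw [map_sub, map_one, aeval_det_mvPolynomialX, sub_eq_zero] at hx1
    have hB := hΦ₀ _ hx1
    show aeval _ (f₀ - aeval _ Φ₀) = 0
    rw [map_sub, sub_eq_zero, ← AlgHom.comp_apply, comp_aeval]
    have hfc : (fun d : DegIdx σ m => aeval (fun ij : σ × σ =>
        (Matrix.of fun i j : σ => x (i, j)) ij.1 ij.2) (genericCoeff w₀ d.1)) =
        formCoeff m (linSubst σ k (Matrix.of fun i j : σ => x (i, j)) w₀) := by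
      funext d
      rw [aeval_genericCoeff_self, formCoeff_apply]
    rw [hfc]
    exact hB
  -- transfer to the `K`-point `g`
  have hy : (fun ij : σ × σ => g ij.1 ij.2) ∈ MvPolynomial.zeroLocus K I := by
    rw [MvPolynomial.zeroLocus_span]
    intro p hp
    rw [Set.mem_singleton_iff] at hp
    rw [hp, map_sub, map_one, aeval_det_mvPolynomialX, hg, sub_self]
  have hK := aeval_eq_zero_of_forall_zeroLocus (K := K) I hk hy
  have hQ : aeval (fun ij : σ × σ => g ij.1 ij.2) Q =
      aeval (fun ij : σ × σ => g ij.1 ij.2) f₀ -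
        aeval (fun ij : σ × σ => g ij.1 ij.2) (aeval (fun d : DegIdx σ m => genericCoeff w₀ d.1) Φ₀) :=
    map_sub _ _ _
  rw [hQ, sub_eq_zero, ← AlgHom.comp_apply, comp_aeval] at hK
  have hfc : (fun d : DegIdx σ m => aeval (fun ij : σ × σ => g ij.1 ij.2) (genericCoeff w₀ d.1)) =
      formCoeff m (linSubst σ K g (map (algebraMap k K) w₀)) := by
    funext d
    rw [aeval_genericCoeff, formCoeff_apply]
  rw [hfc, aeval_def, ← eval_map] at hK
  rw [aeval_map_algebraMap]
  exact hK

end Conclusion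

/-! ### § 3 The theorem over every algebraically closed field of characteristic `0` -/

section Subfield

variable {F : Type} [Field F]

/-- **The coefficients of two polynomials (in possibly different variables) over an algebraically
closed field `F` of characteristic `0` lie in an algebraically closed subfield of cardinality
`≤ 𝔠`**, which embeds into `ℂ` (Steinitz) — the set-up of the algebraic Lefschetz principle
(variant of `exists_algClosed_subfield_pair` with two variable types).
[cite: Milne2017AlgebraicGroups, §1.e (extension of scalars)] -/
theorem exists_algClosed_subfield_pair₂ [IsAlgClosed F] [CharZero F] {σ τ : Type}
    (f : MvPolynomial σ F) (g : MvPolynomial τ F) :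
    ∃ (k : Type) (_ : Field k) (_ : Algebra k F) (_ : IsAlgClosed k) (_ : CharZero k),
      Nonempty (k →+* ℂ) ∧ (∃ f₀ : MvPolynomial σ k, map (algebraMap k F) f₀ = f) ∧
        ∃ g₀ : MvPolynomial τ k, map (algebraMap k F) g₀ = g := by
  classical
  -- the subfield generated by the coefficients and its algebraic closure inside `F`
  let S : Finset F := f.support.image (fun d => coeff d f) ∪ g.support.image (fun d => coeff d g)
  let E : Subfield F := Subfield.closure (S : Set F)
  let k : IntermediateField E F := algebraicClosure E F
  haveI hk : IsAlgClosed k := IsAlgClosure.isAlgClosed E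
  haveI : CharZero k := (algebraMap k F).charZero
  -- cardinality: `#k ≤ max #E ℵ₀ ≤ ℵ₀ ≤ 𝔠`
  have hE : #E ≤ ℵ₀ := by
    refine (Subfield.cardinalMk_closure_le_max (S : Set F)).trans (max_le ?_ le_rfl)
    exact (Cardinal.lt_aleph0_of_finite _).le
  have hkcard : #k ≤ 𝔠 := by
    refine ((Algebra.IsAlgebraic.cardinalMk_le_max E k).trans ?_).trans Cardinal.aleph0_le_continuum
    exact max_le hE le_rfl
  have hemb : Nonempty (k →+* ℂ) :=
    Literature.FieldTheory.AlgClosed.nonempty_ringHom_complex_of_cardinalMk_le_continuum k hkcard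
  -- every coefficient lies in `k`
  have hmem : ∀ x ∈ (S : Set F), x ∈ Set.range (algebraMap k F) := by
    intro x hx
    have hxE : x ∈ E := Subfield.subset_closure hx
    refine ⟨⟨x, ?_⟩, rfl⟩
    have : x = algebraMap E F ⟨x, hxE⟩ := rfl
    rw [this]
    exact IntermediateField.algebraMap_mem k _
  refine ⟨k, inferInstance, inferInstance, hk, inferInstance, hemb,
    exists_map_eq_of_forall_coeff_mem_range f fun d hd => hmem _ ?_,
    exists_map_eq_of_forall_coeff_mem_range g fun d hd => hmem _ ?_⟩
  · exact Finset.mem_coe.mpr (Finset.mem_union_left _ (Finset.mem_image_of_mem _ hd))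
  · exact Finset.mem_coe.mpr (Finset.mem_union_right _ (Finset.mem_image_of_mem _ hd))

end Subfield

/-- **Grosshans 1997, Thm. 1.11 (Borel LAG Prop. 6.7) for closed `SL`-orbits of forms, over every
algebraically closed field of characteristic `0`.** For a polystable form `w` of degree `m` over an
algebraically closed field `F` of characteristic `0`, every polynomial function `f` on `σ × σ`
matrices with `f(g h) = f(g)` for all `g ∈ SL_σ(F)` and all `h ∈ SL_σ(F)` stabilising `w` agrees
on `SL_σ(F)` with `g ↦ Φ(g · w)` for a polynomial `Φ` in the coefficients of degree-`m` forms: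
`F[SL_σ]^{SL_w} = F[SL_σ · w]`, i.e. the orbit map `SL_σ → SL_σ · w` is a quotient by the stabiliser
(separability being automatic in characteristic `0`). Obtained from the tree's `ℂ` theorem
`Grosshans1997_thm_1_11_slOrbit_forms_holds` by the algebraic Lefschetz principle (§§ 1–3).
[cite: Grosshans1997, Thm. 1.11] -/
theorem Grosshans1997_thm_1_11_slOrbit_forms_charZero (F : Type) [Field F] [IsAlgClosed F]
    [CharZero F] {σ : Type} [Fintype σ] [DecidableEq σ] (w : MvPolynomial σ F) {m : ℕ}
    (hw : w.IsHomogeneous m) (hst : IsPolystable w) (f : MvPolynomial (σ × σ) F)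
    (hf : ∀ g h : Matrix σ σ F, g.det = 1 → h.det = 1 → linSubst σ F h w = w →
      MvPolynomial.eval (fun ij : σ × σ => (g * h) ij.1 ij.2) f =
        MvPolynomial.eval (fun ij : σ × σ => g ij.1 ij.2) f) :
    ∃ Φ : MvPolynomial (DegIdx σ m) F, ∀ g : Matrix σ σ F, g.det = 1 →
      MvPolynomial.eval (fun ij : σ × σ => g ij.1 ij.2) f =
        aeval (formCoeff m (linSubst σ F g w)) Φ := by
  classical
  obtain ⟨k, _, _, _, _, ⟨ψ⟩, ⟨w₀, rfl⟩, ⟨f₀, rfl⟩⟩ := exists_algClosed_subfield_pair₂ w f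
  -- (1) descent `F → k`
  have hw₀ : w₀.IsHomogeneous m :=
    MvPolynomial.IsHomogeneous.of_map (algebraMap k F).injective hw
  have hst₀ : IsPolystable w₀ := IsPolystable.of_map (K := F) hst
  have hf₀ := rightStabInvariant_of_map (K := F) w₀ f₀ hf
  -- (2) ascent `k → ℂ` along `ψ`, and the `ℂ` theorem
  letI : Algebra k ℂ := ψ.toAlgebra
  have hf₁ := rightStabInvariant_map (K := ℂ) w₀ f₀ hf₀
  have h₁ := Grosshans1997_thm_1_11_slOrbit_forms_holds.out (hw₀.map (algebraMap k ℂ)) hst₀.map hf₁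
  -- (3) descent `ℂ → k` of the polynomial `Φ`, (4) ascent `k → F`
  obtain ⟨Φ₀, hΦ₀⟩ := exists_orbitQuotientPoly_of_map (K := ℂ) w₀ m f₀ h₁
  exact ⟨map (algebraMap k F) Φ₀, fun g hg => orbitQuotientPoly_map (K := F) w₀ m f₀ Φ₀ hΦ₀ g hg⟩

end Literature.Computability.AlgebraicComplexity

end
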